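import Mathlib
import HarnessLib
import HarnessLib.Audit
import Summits.AnomalousDissipation.Statement
import Literature.Analysis.FluidPDE.SuitableWeak

/-!
Route: HomogeneousForceArena

CLOSED (retired) 2026-08-15T13:36:05Z by operator:999:1090267 — reason: not-a-thesis: assembly does not conclude the sub-problem Statement — note: D-0027 §2.1 audit (human 2026-08-15: routes that do not decide the summit are removed): the assembly concludes `ArenaZerothLaw`, not the sub-problem statement; a NEW conforming route may be opened from the same idea (generated `closes : … → _root_.AnomalousDissipation`).. The file is kept as the record of this route; refuted decls are indexed as negative knowledge (`ledger negatives`).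

Route HomogeneousForceArena — an ARENA for AnomalousDissipation (= Literature.Turb.ZerothLaw),
realising idea card homogeneous-force-phragmen-lindelof-arena ("Kolmogorov's law as a
Phragmén–Lindelöf alternative"). No transfer to T³ is claimed: the Assembly ends in the arena
statement ArenaZerothLaw — the summit statement with T³ replaced by the unit shell A₁ = {1 < |x| <
2} of ℝ³ and the smooth force by a homogeneous stirrer — exactly as route Parity/CubicRoots ends in
its special-case target CubicBH.

ARENA. On ℝ³ take a steady force F homogeneous of degree −β, F(c x) = c^{−β} F(x), smooth and
divergence-free off the origin with curl F ≢ 0, in the window 3/2 < β < 5/2 (then F ∈ L² at infinity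
and F ∈ L^{6/5} ⊂ Ḣ⁻¹ near 0, so F ∈ L² + Ḣ⁻¹(ℝ³): the finite-energy Leray–Hopf theory applies at
EVERY viscosity, the force is exactly homogeneous, nothing is mollified). The space–time scaling
u(s, y) = R^{(β−1)/2} U(R^{(β+1)/2} s, R y) maps Leray–Hopf / CKN-suitable solutions of NS with
viscosity 1 and force F to solutions with viscosity ν = R^{(β−3)/2} and THE SAME force (tree,
proved: Literature.Analysis.FluidPDE.IsSuitableWeakSolutionOn.stRescale,
IsDistributionalNSSolutionOn.stRescale, HasWeakSpatialGradientOn.stRescale,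
IsLerayHopfOn.nsRescale_holds, with α = R^{(β−1)/2}, γ = R: the force factor α²γ = R^β is cancelled
by homogeneity). Because β < 3, ν → 0 ⟺ R → ∞: a vanishing-viscosity family read on the unit shell
IS one unit-viscosity solution U read on the shells A_R = {R < |y| < 2R}; shell energy transforms by
R^{β−4}, ν × shell dissipation by R^{(3β−7)/2}, long-time Cesàro means are invariant. Kolmogorov's
ν-independence becomes scale covariance at spatial infinity of a single parameter-free flow, and the
laminar/turbulent dichotomy becomes a Liouville-type alternative between two homogeneity degrees:
LAMINAR (Stokes balance ΔU ~ F) shell energy ≍ R^{7−2β}, shell dissipation ≍ R^{5−2β}; INERTIAL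
(U·∇U ~ F, Kolmogorov) shell energy ≍ R^{4−β}, shell dissipation ≍ R^{(7−3β)/2} = local injection;
the local Reynolds number R·|U| → ∞ along rays in both regimes.

THESIS X (item KolmogorovExponents; "it suffices to show X"): there are β ∈ (3/2, 5/2), a stirrer F
as above, and ONE global finite-energy Leray–Hopf solution U of NS₁(F) on ℝ³ from an L² datum,
CKN-suitable on (0,∞) × ℝ³, whose far field carries the two KOLMOGOROV EXPONENTS: shell-energy means
⟨∫_{A_R} |U|²⟩ ≤ C R^{4−β} for every R ≥ 1 (inertial level, NOT the laminar R^{7−2β}), and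
shell-dissipation means ⟨∫_{A_R} |∇U|²⟩ ≥ c R^{(7−3β)/2} frequently in time for all large R
(turbulence dissipates at each radius what the force injects there).
Lean (elaborated rc 0 in the planner's Sketch.lean together with the whole route and the glue
`assembly_glue : Assembly`): def KolmogorovExponents — ∃ β, 3/2 < β ∧ β < 5/2 ∧ ∃ F, ContDiffOn ℝ ∞
F {0}ᶜ ∧ (∀ c > 0, ∀ x, F (c • x) = c^(−β) • F x) ∧ (∀ x ≠ 0, VectorCalculus.divergence F x = 0) ∧
(∃ x ≠ 0, curl F x ≠ 0) ∧ ∃ u₀ U P, IsGlobalLerayHopf 1 (fun _ => F) u₀ U ∧ IsSuitableWeakSolutionOn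
(slab E³ (Ioi 0)) 1 (fun _ => F) U P ∧ (∃ C, ∀ R ≥ 1, ∀ᶠ T in atTop, timeMean (t ↦ ∫_{A_R} ‖U t x‖²)
T ≤ C R^(4−β)) ∧ ∃ c > 0, ∃ R₀ G, HasWeakSpatialGradientOn (slab E³ (Ioi 0)) U G ∧ ∀ R ≥ R₀, ∃ᶠ T in
atTop, c R^((7−3β)/2) ≤ timeMean (t ↦ ∫_{A_R} |G t x|²) T. All constants exist
(Literature.Analysis.FluidPDE.{IsGlobalLerayHopf, IsSuitableWeakSolutionOn,
HasWeakSpatialGradientOn, slab, timeMean, frobeniusNormSq, curl, VectorCalculus.divergence}). Means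
are junk-free by design: upper bounds as `∀ᶠ T in atTop, timeMean g T ≤ …`, lower bounds as `∃ᶠ T in
atTop, … ≤ timeMean g T` (the real limsup of an unbounded Cesàro mean is the junk value 0).

ASSEMBLY X → ArenaZerothLaw: item ScalingConjugacy (KolmogorovExponents → ArenaZerothLaw: rescale U
by R_j → ∞, ν_j = R_j^{(β−3)/2} → 0; pure bookkeeping over the proved covariance lemmas). X is
opened crux-first: KolmogorovSaturation (∃ U at the inertial ENERGY level, rank 3) and
NoConicalDodger (every suitable Leray–Hopf solution at the inertial energy level dissipates at the
inertial rate — the Liouville / Phragmén–Lindelöf statement for one parameter-free flow, rank 2).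
Assembly := NoConicalDodger → KolmogorovSaturation → ScalingConjugacy → ArenaZerothLaw (glue is
∃-unpacking; checked). PlanarCalibration (rank 4) is the 2-D sanity crux demanded by the novelty
audit: the same conjugacy on ℝ² must NOT produce a Kolmogorov dissipation level (Alexakis–Doering
transplanted); it is deliberately outside the Assembly — its refutation would decouple the arena
from the zeroth law and close the route.

Rationale: WHY THIS LINE. The card trades the vanishing-viscosity limit for a spatial limit inside ONE flow:
for a force homogeneous of degree −β with β < 3, the NS scaling with exponent h = (1−β)/2
(Frisch1995 §2.2: for ν > 0 only h = −1 survives unless ν is rescaled — here the homogeneous force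
pays for the rescaling) is an exact conjugacy NS_ν(F) ≅ NS_1(F), so every tool that needs "a fixed
equation and a limit at infinity" — Liouville theorems with growth (KNSS2009, Seregin2016,
ChaeWolf2019, Tsai2021Liouville), Saint-Venant / Phragmén–Lindelöf energy alternatives (Oleinik,
Equadiff IV 1977 doi:10.1007/bfb0067248 pp. 282–293; Ladyzhenskaya–Solonnikov
doi:10.1007/bf01094437; Galdi2011), blow-down compactness in the local energy class
(LemarieRieusset2016 Ch. 14, KikuchiSeregin2007, BradshawTsai2020), CKN local budgets
(CaffarelliKohnNirenberg1982) — applies to a fixed-force zeroth law verbatim. Imported area: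
elliptic/parabolic Liouville–growth theory + the tree's PROVED space–time covariance of
suitable/Leray–Hopf solutions (IsSuitableWeakSolutionOn.stRescale etc.); physics dictionary =
Frisch1995 §6.1 (K41 as restored scale invariance, exponent h) with h pinned to (1−β)/2 by the
force, and the Doering–Foias laminar-vs-turbulent saturation (DoeringFoias2002 §3) which becomes the
two growth degrees 7−2β vs 4−β of shell energy. Design choices made here (beyond the card, following
its novelty audit): window 3/2 < β < 5/2 so that F ∈ L² + Ḣ⁻¹ and the whole arena lives in the
FINITE-ENERGY global Leray–Hopf class at every ν (no local-energy/infinite-energy theory, no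
mollified core, exact conjugacy — the audit's points (i)–(ii) are dissolved rather than patched);
junk-free Cesàro clauses; the planar calibration (audit point (iii)) filed as a crux.
FOUND WHILE PLANNING (support, provable now): InertialEnergyFloor — the Doering–Foias lower bound
transplants shell-wise: testing the time-averaged weak formulation with ψ(x/R)θ(t/T) and using
homogeneity, shell energy ≤ εR^{4−β} on one shell forces |∫_{A₁} F·ψ| ≤ C(ε + ε^{1/2}), so for ε <
ε₀(F) the stirrer would be a gradient on A₁ (de Rham), contradicting curl F ≢ 0. Hence EVERY
Leray–Hopf solution sits at or above the inertial energy level on every shell R ≥ 1, and X asks for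
one that SATURATES the floor (Kolmogorov saturation = Re ~ Gr^{1/2}) and dissipates accordingly: the
alternative is sharp on the energy side.
RANKED CRUXES. r2 NoConicalDodger (hardest, most informative): ∀ β, F, ∀ suitable global LH U of
NS₁(F): inertial shell-energy bound ⟹ inertial shell-dissipation floor. The Liouville side: a
sub-dissipative far field at inertial energy would blow down (U_R = R^{(β−1)/2}U(R^{(β+1)/2}·, R·),
local compactness) to a work-free statistically stationary forced-Euler state of homogeneity (1−β)/2
— a "conical dodger"; the crux says none exists (cf. Shvydkoy2015: no smooth (−1)-homogeneous steady
Euler fields; flexible at other degrees, arXiv:1310.8611). r3 KolmogorovSaturation: ∃ β, F, U at the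
inertial energy level (the arena's bounded-energy clause; negation = laminar locking S(R) ≍ R^{7−2β}
for every solution). r4 PlanarCalibration (not in the Assembly): on ℝ² (window 1 < β < 2) inertial
energy ⟹ dissipation o(R^{(5−3β)/2}) — the arena must reproduce the 2-D failure of the zeroth law
(AlexakisDoering2006PLA); naive shell enstrophy budgets do not close (flux/injection ≍ R^{1/2−β/6}),
so this is a genuine statement.
SUPPORT (rank 9, unranked for staffing): ScalingConjugacy (X → ArenaZerothLaw), InertialEnergyFloor,
ForcedLerayExistence (global LH + suitable solutions on ℝ³ for F ∈ L² + L^{6/5}, any ν > 0, any L²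
div-free datum: Leray1934 scheme with force; the term ∫∫ F·u_n φ passes to the limit since Fφ ∈
L^{6/5+} pairs with the strong L²_t L^{6−}_loc convergence).
KILL CRITERIA. (a) KolmogorovSaturation refuted for ALL stirrers (laminar locking is universal) ⇒
the ∃-form arena law is false ⇒ close refuted. (b) NoConicalDodger refuted by an explicit dodger for
EVERY F (not just symmetric subclasses) ⇒ close; refuted only on a symmetric subclass (axisymmetric
swirl, Rayleigh-stable) ⇒ restate with a genericity hypothesis on the angular profile (one repair).
(c) PlanarCalibration refuted (a planar solution with Kolmogorov exponents) ⇒ the arena does not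
track the zeroth law's dimension dependence ⇒ close as physically void. (d) Novelty audit finds the
supercritical conjugacy + growth alternative in print ⇒ regrade, keep only if cruxes remain open
there.
NOT DECOMPOSED YET (tenure, after a crux moves): the split of NoConicalDodger into Blow-down
compactness (sub-dissipative inertial far fields converge along R → ∞ to stationary statistical
forced-Euler states with zero shell injection; needs a Literature definition of local-topology
statistical solutions on ℝ³) + Conical rigidity (no such work-free (1−β)/2-homogeneous Euler
statistics for stirrers with full SO(3)-orbit support); the radial energy-flux identity Φ′(R) =
injection − dissipation on spheres (card H5) as support under NoConicalDodger; dilation-averaged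
(scaling-invariant) stationary statistics as the canonical K41 candidate (card (i)); the
three-annuli form of the alternative (no intermediate growth degree); the β = 2 'Biot–Savart
stirrer' F = (x × e₃)/|x|³ as showcase for certified numerics (unit viscosity, growing box).

Novelty: DELTA (self-grade new-combination, agreeing with the card's audit): using SUPERcritical homogeneity
3/2 < β < 5/2 of a deterministic steady force to make Frisch's h = (1−β)/2 scaling an exact
conjugacy NS_ν(F) ≅ NS₁(F) inside the finite-energy Leray–Hopf class (tree-proved covariance
lemmas), so that the fixed-force zeroth law on the unit shell becomes a two-homogeneity-degree
growth alternative (laminar 7−2β vs inertial 4−β in shell energy; dissipation floor (7−3β)/2) for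
ONE unit-viscosity solution at spatial infinity, with the Doering–Foias bound reappearing as a
provable shell-wise inertial energy FLOOR (InertialEnergyFloor, from homogeneity + de Rham) and 'no
conical dodger' as the Liouville crux — not found in (1)–(5): (1) has the group but no force and no
theorem, (2) is perturbative with Gaussian white forcing, (3) sits at the degenerate degree, (4) has
alternatives but no scaling symmetry tying the two rates to the zeroth law. NEAREST PRIOR ART
actually found: (1) Frisch1995 §2.2 (PDF pp. 15–16 = book pp. 17–18): the scaling groups (t, r, v) ↦
(λ^{1−h}t, λr, λ^h v), "for finite viscosity only h = −1 is permitted … similarity principle", and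
§6.1 (book pp. 72–75) hypotheses H1–H3: K41 = statistical restoration of scale invariance at small
scales with exponent h. (2) Forster–Nelson–Stephen 1977, doi:10.1103/PhysRevA.16.732, as presented
in McComb2003 (doi:10.1093/oso/9780198506942.001.0001) §11.3 (PDF pp. 265–268): RG for a RANDOMLY
stirred fluid with power-law force c  [refs: 10.1103/PhysRevA.16.732, 10.1093/oso/9780198506942.001.0001, 10.1007/bfb0067248, 10.1007/bf01094437., 10.1090/tran/7022, 1310.8611, doi:10.1103/PhysRevA.16.732, doi:10.1093/oso/9780198506942.001.0001, doi:10.1007/bfb0067248, doi:10.1007/bf01094437., doi:10.1090/tran/7022, Frisch1995, Sverak2011, JiaSverak2014, AlbrittonBrueColombo2022, KNSS2009, Seregin2016, ChaeWolf2019, Galdi2011, Shvydkoy2015]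

Barriers (technique_class: scaling-conjugacy liouville-growth-alternative arena): Literature.Barriers.AnomalousDissipation.Cheskidov2023_thm13_not_forceRobustNoAnomaly (class
ForceRobustNoAnomaly): blocks force-robust ENERGY-METHOD proofs of the negative ZerothLawNeg; this
route is positive-side, and its one universally quantified item NoConicalDodger derives a
dissipation FLOOR from the energy level using the exact homogeneity of the fixed steady force
(scaling covariance, blow-down), i.e. it is not stable under C(ℝ;L²)-perturbations of the force —
outside the class; InertialEnergyFloor IS an energy-method statement but a lower bound on energy,
which the barrier does not address. Not met.
Literature.Barriers.AnomalousDissipation.BuckmasterVicol2019_thm13 (convex integration gives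
non-Leray solutions): every solution in every item is a finite-energy global Leray–Hopf solution,
CKN-suitable where budgets are used; wild weak solutions are excluded by hypothesis, and
KolmogorovSaturation cannot be discharged by present convex-integration schemes (they do not produce
Leray–Hopf + local energy inequality at fixed ν = 1). Not met; not evaded either — the bet is on
genuine NS dynamics.
Literature.Barriers.AnomalousDissipation.BrueDeLellis2023_noAnomaly_beforeEulerSingularity and
Literature.Barriers.AnomalousDissipation.BrenierDeLellisSzekelyhidi2011_cor1 (finite window + strong
Euler solution ⇒ no anomaly): the arena's clauses are long-time Cesàro means on far shells of one ν
= 1 flow; no finite-window vanishing-viscosity limit towards a classical Euler solution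

History (route lifecycle, newest last):
- 2026-08-15T13:36:06Z · CLOSED retired — not-a-thesis: assembly does not conclude the sub-problem Statement (operator:999:1090267)

sub-problem: AnomalousDissipation · status: closed(retired) · opened planner-plancard-AnomalousDissipation-Anomalo-dc620344-0 2026-08-15T11:09:47Z · rev 1 · ledger route-AnomalousDissipation-HomogeneousForceArena
GENERATED by the gate from the ledger (D-0016/17). Provers cite these decls: `theorem foo : Summit.AnomalousDissipation.AnomalousDissipation.Theses.HomogeneousForceArena.<Decl> := …` in Summits/AnomalousDissipation/AnomalousDissipation/Theorems/<Name>.lean.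
-/

namespace Summit.AnomalousDissipation.AnomalousDissipation.Theses.HomogeneousForceArena

open scoped BigOperators Topology Manifold Classical MeasureTheory ProbabilityTheory Matrix InnerProductSpace ComplexConjugate ContinuousMap
open Filter Set Function TopologicalSpace MeasureTheory

attribute [summit_statement] _root_.AnomalousDissipation

open Literature.Turb

/-- item stmt-AnomalousDissipation-2967 · target · rank 0 · closed · moot by None · by planner
why it might fail: ∃-form arena law: false if laminar locking is universal (¬KolmogorovSaturation for every stirrer) or a conical dodger exists for every stirrer; it is the fixed-force, unit-shell copy of an open law (no rigorous instance of the zeroth law for steady smooth forcing is known).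
sources: DoeringFoias2002, Frisch1995, BrueDeLellis2023, Cheskidov2023
[target] THE ARENA STATEMENT (summit shape with T³ ↦ unit shell A₁ = {1<|x|<2} of ℝ³ and smooth f ↦
homogeneous stirrer): ∃ β ∈ (3/2,5/2), ∃ F homogeneous of degree −β, C^∞ and divergence-free off the
origin with curl F ≢ 0, ∃ ν_j > 0 with ν_j → 0, L² data u₀ⱼ and GLOBAL finite-energy Leray–Hopf
solutions u_j of NS_{ν_j} on ℝ³ forced by the SAME steady F (tree E-side IsGlobalLerayHopf), with
uniformly bounded long-time shell-energy means on A₁ (∃ E ∀ j: Cesàro means of ∫_{A₁}|u_j|²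
eventually ≤ E) and shell dissipation bounded below (∃ ε > 0 ∀ j: some weak spatial gradient G_j of
u_j on (0,∞)×ℝ³ has Cesàro means of ν_j∫_{A₁}|G_j|² ≥ ε frequently in T). Junk notes: `∀ᶠ T in
atTop, timeMean g T ≤ …` / `∃ᶠ T in atTop, … ≤ timeMean g T` replace the summit's real limsup (junk
0 on unbounded Cesàro means); ∃ G rather than ∀ G so the dissipation clause cannot hold vacuously
(weak spatial gradients are a.e. unique). NOT claimed to imply AnomalousDissipation: this route is
an ARENA (card §Assembly sketch); precedent Parity/CubicRoots → CubicBH. -/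
@[route_item "route-AnomalousDissipation-HomogeneousForceArena"]
def ArenaZerothLaw : Prop :=
  ∃ β : ℝ, 3 / 2 < β ∧ β < 5 / 2 ∧ ∃ F : EuclideanSpace ℝ (Fin 3) → EuclideanSpace ℝ (Fin 3), ContDiffOn ℝ ((⊤ : ℕ∞) : WithTop ℕ∞) F {0}ᶜ ∧ (∀ c : ℝ, 0 < c → ∀ x, F (c • x) = (c ^ (-β)) • F x) ∧ (∀ x, x ≠ 0 → Literature.Analysis.FluidPDE.VectorCalculus.divergence F x = 0) ∧ (∃ x, x ≠ 0 ∧ Literature.Analysis.FluidPDE.curl F x ≠ 0) ∧ ∃ (ν : ℕ → ℝ) (u₀ : ℕ → EuclideanSpace ℝ (Fin 3) → EuclideanSpace ℝ (Fin 3)) (u : ℕ → ℝ → EuclideanSpace ℝ (Fin 3) → EuclideanSpace ℝ (Fin 3)), (∀ j, 0 < ν j) ∧ Tendsto ν atTop (𝓝 0) ∧ (∀ j, Literature.Analysis.FluidPDE.IsGlobalLerayHopf (ν j) (fun _ => F) (u₀ j) (u j)) ∧ (∃ E : ℝ, ∀ j, ∀ᶠ T in atTop, Literature.Analysis.FluidPDE.timeMean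 (fun t => ∫ x in {x : EuclideanSpace ℝ (Fin 3) | 1 < ‖x‖ ∧ ‖x‖ < 2}, ‖u j t x‖ ^ 2) T ≤ E) ∧ ∃ ε : ℝ, 0 < ε ∧ ∀ j, ∃ G : ℝ → EuclideanSpace ℝ (Fin 3) → EuclideanSpace ℝ (Fin 3) →L[ℝ] EuclideanSpace ℝ (Fin 3), Literature.Analysis.FluidPDE.HasWeakSpatialGradientOn (Literature.Analysis.FluidPDE.slab (EuclideanSpace ℝ (Fin 3)) (Ioi 0) isOpen_Ioi) (u j) G ∧ ∃ᶠ T in atTop, ε ≤ Literature.Analysis.FluidPDE.timeMean (fun t => ν j * ∫ x in {x : EuclideanSpace ℝ (Fin 3) | 1 < ‖x‖ ∧ ‖x‖ < 2}, Literature.Analysis.FluidPDE.frobeniusNormSq (G t x)) T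

/-- item stmt-AnomalousDissipation-2968 · crux · rank 2 · closed · moot by None · by planner
why it might fail: A dodger may exist: far field at inertial amplitude R^{(1−β)/2} but smooth at scale R (dissipation R^{2−β} ≪ R^{(7−3β)/2}), work-free (⟨F·U⟩≈0) or radiating injected power (flux capacity U³R² ≍ injection); homogeneous Euler fields are rigid only at special degrees (Shvydkoy2015, LuoShvydkoy2015).
sources: Shvydkoy2015, LuoShvydkoy2015, arXiv:1310.8611, BangYang2025, KNSS2009, Seregin2016
[crux] NO CONICAL DODGER (the Liouville / Phragmén–Lindelöf side): for every β ∈ (3/2,5/2), every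
stirrer F (homogeneous −β, C^∞ and div-free off 0, curl F ≢ 0), every L² datum and every global
Leray–Hopf solution U of NS₁(F) that is CKN-suitable on (0,∞)×ℝ³: IF the far field is at the
inertial ENERGY level (∃ C ∀ R ≥ 1: Cesàro means of ∫_{A_R}|U|² eventually ≤ C R^{4−β}) THEN it
dissipates at the inertial RATE (∃ c > 0, R₀, weak spatial gradient G of U: ∀ R ≥ R₀, Cesàro means
of ∫_{A_R}|G|² ≥ c R^{(7−3β)/2} frequently). Second layer foreseen (not filed; tenure split): a
counterexample's blow-downs U_R(s,y) = R^{(β−1)/2}U(R^{(β+1)/2}s, Ry) solve NS with viscosity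
R^{(β−3)/2} → 0 and the SAME force, are bounded in the local energy class (hypothesis) with
vanishing dissipation on A₁, and InertialEnergyFloor keeps them non-trivial; local compactness
yields a statistically stationary forced-EULER state on ℝ³∖{0}, (1−β)/2-homogeneous in law, with
ZERO mean injection ⟨F·u⟩ on every shell — a 'conical dodger'; the crux is that no such object
exists for stirrers with curl F ≢ 0 (compare Shvydkoy2015: no smooth (−1)-homogeneous steady Euler
field on ℝ³∖{0}; other degrees are flexible, arXiv -/
@[route_item "route-AnomalousDissipation-HomogeneousForceArena"]
def NoConicalDodger : Prop :=
  ∀ β : ℝ, 3 / 2 < β → β < 5 / 2 → ∀ F : EuclideanSpace ℝ (Fin 3) → EuclideanSpace ℝ (Fin 3), ContDiffOn ℝ ((⊤ : ℕ∞) : WithTop ℕ∞) F {0}ᶜ → (∀ c : ℝ, 0 < c → ∀ x, F (c • x) = (c ^ (-β)) • F x) → (∀ x, x ≠ 0 → Literature.Analysis.FluidPDE.VectorCalculus.divergence F x = 0) → (∃ x, x ≠ 0 ∧ Literature.Analysis.FluidPDE.curl F x ≠ 0) → ∀ (u₀ : EuclideanSpace ℝ (Fin 3) → EuclideanSpace ℝ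 (Fin 3)) (U : ℝ → EuclideanSpace ℝ (Fin 3) → EuclideanSpace ℝ (Fin 3)) (P : ℝ → EuclideanSpace ℝ (Fin 3) → ℝ), Literature.Analysis.FluidPDE.IsGlobalLerayHopf 1 (fun _ => F) u₀ U → Literature.Analysis.FluidPDE.IsSuitableWeakSolutionOn (Literature.Analysis.FluidPDE.slab (EuclideanSpace ℝ (Fin 3)) (Ioi 0) isOpen_Ioi) 1 (fun _ => F) U P → (∃ C : ℝ, ∀ R : ℝ, 1 ≤ R → ∀ᶠ T in atTop, Literature.Analysis.FluidPDE.timeMean (fun t => ∫ x in {x : EuclideanSpace ℝ (Fin 3) | R < ‖x‖ ∧ ‖x‖ < 2 * R}, ‖U t x‖ ^ 2) T ≤ C * R ^ (4 - β)) → ∃ c : ℝ, 0 < c ∧ ∃ R₀ : ℝ, ∃ G : ℝ → EuclideanSpace ℝ (Fin 3) → EuclideanSpace ℝ (Fin 3) →L[ℝ] EuclideanSpace ℝ (Fin 3), Literature.Analysis.FluidPDE.HasWeakSpatialGradientOn (Literature.Analysis.FluidPDE.slab (EuclideanSpace ℝ (Fin 3)) (Ioi 0) isOpen_Ioi) U G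 ∧ ∀ R : ℝ, R₀ ≤ R → ∃ᶠ T in atTop, c * R ^ ((7 - 3 * β) / 2) ≤ Literature.Analysis.FluidPDE.timeMean (fun t => ∫ x in {x : EuclideanSpace ℝ (Fin 3) | R < ‖x‖ ∧ ‖x‖ < 2 * R}, Literature.Analysis.FluidPDE.frobeniusNormSq (G t x)) T

/-- item stmt-AnomalousDissipation-2969 · crux · rank 3 · closed · moot by None · by planner
why it might fail: Laminar locking: for every stirrer all Leray–Hopf far fields may relax to the Stokes level S(R) ≍ R^{7−2β} (arena analogue of Marchioro1986; Rayleigh-stable swirl stirrers) or saturate at a degree strictly between 4−β and 7−2β; Re ≍ Gr^{1/2} saturation of the DF bound is unproved for steady forces.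
sources: DoeringFoias2002, Marchioro1986, CheskidovDoeringPetrov2007, Frisch1995, Cheskidov2023, KanedaEtAl2003
[crux] KOLMOGOROV SATURATION (the arena's bounded-energy clause): ∃ β ∈ (3/2,5/2), a stirrer F
(class as in NoConicalDodger), an L² datum and a global Leray–Hopf solution U of NS₁(F),
CKN-suitable on (0,∞)×ℝ³, whose shell-energy Cesàro means satisfy ∀ R ≥ 1: eventually ≤ C R^{4−β} —
the far field SATURATES the inertial floor of InertialEnergyFloor (Doering–Foias' turbulent branch
Re ≍ Gr^{1/2}) instead of the laminar level R^{7−2β} (Re ≍ Gr). The prover chooses β and F: F =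
curl(|x|^{1−β}A(x̂)) exhausts the class; choose the most unstable angular profile; showcase β = 2,
the 'Biot–Savart stirrer' F = (x×e₃)/|x|³ (laminar far field |U| ≍ const with Re = R, Kolmogorov far
field |U| ≍ R^{−1/2}). Existence of U as such is the support item ForcedLerayExistence; the content
is the uniform-in-R bound on the long-time shell means (spin-up: |U| grows like R^{−β}t until the
eddy time R^{(1+β)/2}, then saturates at R^{(1−β)/2} if K41 holds, or keeps growing to R^{2−β} at
the viscous time R²). WHY IT MIGHT FAIL: every Leray–Hopf solution might lock onto the laminar level
(instabilities saturating sub-inertially, e.g. for centrifugally stable swirl stirrers) for some or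
even all F — universal l -/
@[route_item "route-AnomalousDissipation-HomogeneousForceArena"]
def KolmogorovSaturation : Prop :=
  ∃ β : ℝ, 3 / 2 < β ∧ β < 5 / 2 ∧ ∃ F : EuclideanSpace ℝ (Fin 3) → EuclideanSpace ℝ (Fin 3), ContDiffOn ℝ ((⊤ : ℕ∞) : WithTop ℕ∞) F {0}ᶜ ∧ (∀ c : ℝ, 0 < c → ∀ x, F (c • x) = (c ^ (-β)) • F x) ∧ (∀ x, x ≠ 0 → Literature.Analysis.FluidPDE.VectorCalculus.divergence F x = 0) ∧ (∃ x, x ≠ 0 ∧ Literature.Analysis.FluidPDE.curl F x ≠ 0) ∧ ∃ (u₀ : EuclideanSpace ℝ (Fin 3) → EuclideanSpace ℝ (Fin 3)) (U : ℝ → EuclideanSpace ℝ (Fin 3) → EuclideanSpace ℝ (Fin 3)) (P : ℝ → EuclideanSpace ℝ (Fin 3) → ℝ), Literature.Analysis.FluidPDE.IsGlobalLerayHopf 1 (fun _ => F) u₀ U ∧ Literature.Analysis.FluidPDE.IsSuitableWeakSolutionOn (Literature.Analysis.FluidPDE.slab (EuclideanSpace ℝ (Fin 3)) (Ioi 0)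 isOpen_Ioi) 1 (fun _ => F) U P ∧ ∃ C : ℝ, ∀ R : ℝ, 1 ≤ R → ∀ᶠ T in atTop, Literature.Analysis.FluidPDE.timeMean (fun t => ∫ x in {x : EuclideanSpace ℝ (Fin 3) | R < ‖x‖ ∧ ‖x‖ < 2 * R}, ‖U t x‖ ^ 2) T ≤ C * R ^ (4 - β)

/-- item stmt-AnomalousDissipation-2970 · crux · rank 4 · closed · moot by None · by planner
why it might fail: ℝ² shell enstrophy budgets do not close: advective enstrophy flux through S_R is not subordinate to local injection (ratio ≍ R^{1/2−β/6}); energy exported by the stirred core (inverse cascade = outward flux) may keep far-shell dissipation inertial; for β>5/3 it may void the energy clause (vacuity).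
sources: AlexakisDoering2006PLA, Literature.Barriers.AnomalousDissipation.AlexakisDoering2006_energyDissipationBound, LuoShvydkoy2015, ConstantinRamos2007, arXiv:2606.04218, DoeringFoias2002
[crux — CALIBRATION, deliberately NOT in the Assembly] THE PLANAR ARENA MUST FAIL: on ℝ² with F
homogeneous of degree −β, 1 < β < 2 (F ∈ L² + Ḣ⁻¹(ℝ²)), C^∞ and div-free off 0, for every global
Leray–Hopf solution U of NS₁(F) at the inertial energy level (∃ C ∀ R ≥ 1: Cesàro means of
∫_{A_R}|U|² eventually ≤ C R^{3−β}) and every weak spatial gradient G of U on (0,∞)×ℝ²: shell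
dissipation is o(Kolmogorov), ∀ c > 0 ∃ R₀ ∀ R ≥ R₀: Cesàro means of ∫_{A_R}|G|² eventually ≤ c
R^{(5−3β)/2}. (Same conjugacy in 2-D: ν = R^{(β−3)/2}, shell-energy factor R^{β−3}, ν×dissipation
factor R^{(3β−5)/2}; so this says the fixed-force planar shell zeroth law fails, as the zeroth law
does on T² by Alexakis–Doering — the novelty audit's requested sanity check (iii).) Heuristic:
Ens(R) ≲ S^{1/2}Pal^{1/2}, Pal ≲ R^{−β}Ens^{1/2} + fluxes ⇒ Ens ≲ R^{2−4β/3} = o(R^{(5−3β)/2}) for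
every β < 3, IF shell fluxes are subordinate. WHY IT MIGHT FAIL: the advective enstrophy flux
through S_R is NOT a priori subordinate to local enstrophy injection (ratio ≍ R^{1/2−β/6},
increasing); enstrophy exported by the strongly stirred core, or inverse-cascade transport of energy
across shells, could keep far-shell dissipation a -/
@[route_item "route-AnomalousDissipation-HomogeneousForceArena"]
def PlanarCalibration : Prop :=
  ∀ β : ℝ, 1 < β → β < 2 → ∀ F : EuclideanSpace ℝ (Fin 2) → EuclideanSpace ℝ (Fin 2), ContDiffOn ℝ ((⊤ : ℕ∞) : WithTop ℕ∞) F {0}ᶜ → (∀ c : ℝ, 0 < c → ∀ x, F (c • x) = (c ^ (-β)) • F x) → (∀ x, x ≠ 0 → Literature.Analysis.FluidPDE.VectorCalculus.divergence F x = 0) → ∀ (u₀ : EuclideanSpace ℝ (Fin 2) → EuclideanSpace ℝ (Fin 2)) (U : ℝ → EuclideanSpace ℝ (Fin 2) → EuclideanSpace ℝ (Fin 2)), Literature.Analysis.FluidPDE.IsGlobalLerayHopf 1 (fun _ => F) u₀ U → (∃ C : ℝ, ∀ R : ℝ, 1 ≤ R → ∀ᶠ T in atTop, Literature.Analysis.FluidPDE.timeMean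 (fun t => ∫ x in {x : EuclideanSpace ℝ (Fin 2) | R < ‖x‖ ∧ ‖x‖ < 2 * R}, ‖U t x‖ ^ 2) T ≤ C * R ^ (3 - β)) → ∀ G : ℝ → EuclideanSpace ℝ (Fin 2) → EuclideanSpace ℝ (Fin 2) →L[ℝ] EuclideanSpace ℝ (Fin 2), Literature.Analysis.FluidPDE.HasWeakSpatialGradientOn (Literature.Analysis.FluidPDE.slab (EuclideanSpace ℝ (Fin 2)) (Ioi 0) isOpen_Ioi) U G → ∀ c : ℝ, 0 < c → ∃ R₀ : ℝ, ∀ R : ℝ, R₀ ≤ R → ∀ᶠ T in atTop, Literature.Analysis.FluidPDE.timeMean (fun t => ∫ x in {x : EuclideanSpace ℝ (Fin 2) | R < ‖x‖ ∧ ‖x‖ < 2 * R}, Literature.Analysis.FluidPDE.frobeniusNormSq (G t x)) T ≤ c * R ^ ((5 - 3 * β) / 2)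

/-- item stmt-AnomalousDissipation-2971 · target · rank 5 · closed · moot by None · by planner
why it might fail: = NoConicalDodger-conclusion ∧ KolmogorovSaturation for one (β,F,U): fails if laminar locking is universal, if saturation is intermediate (degree strictly between 4−β and 7−2β), or if every inertial-level far field dodges (work-free / radiating).
sources: Frisch1995, DoeringFoias2002, Shvydkoy2015, CheskidovDoeringPetrov2007
[target] THESIS X = HZL, the two-exponent statement for ONE parameter-free flow: ∃ β ∈ (3/2,5/2), a
stirrer F (homogeneous −β, C^∞ and div-free off 0, curl F ≢ 0), an L² datum u₀ and a global
Leray–Hopf solution U of NS with ν = 1 forced by F, CKN-suitable with some pressure P on (0,∞)×ℝ³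
(IsSuitableWeakSolutionOn (slab E³ (Ioi 0))), such that (ENERGY EXPONENT ≤ Kolmogorov) ∃ C ∀ R ≥ 1:
Cesàro means of ∫_{A_R}|U|², A_R = {R<|y|<2R}, are eventually ≤ C R^{4−β}; and (DISSIPATION EXPONENT
≥ Kolmogorov) ∃ c > 0, R₀ and a weak spatial gradient G of U on the slab with ∀ R ≥ R₀: Cesàro means
of ∫_{A_R}|G|² ≥ c R^{(7−3β)/2} frequently. Dictionary: |U| ≍ R^{(1−β)/2} on A_R, local Reynolds
number R·|U| ≍ R^{(3−β)/2} → ∞, local injection R³·R^{−β}·R^{(1−β)/2} = R^{(7−3β)/2} = local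
dissipation (turbulence dissipates at each radius what is injected there); the laminar competitors
are R^{7−2β} (energy) and R^{5−2β} (dissipation), larger by R^{3−β} resp. R^{(3−β)/2}.
ScalingConjugacy turns X into ArenaZerothLaw; X = NoConicalDodger ∧ KolmogorovSaturation glued (term
`assembly_glue` in the planner's Sketch). Sources: card homogeneous-force-phragmen-lindelof-arena;
Frisch1995 §2.2, §6.1; DoeringFo -/
@[route_item "route-AnomalousDissipation-HomogeneousForceArena"]
def KolmogorovExponents : Prop :=
  ∃ β : ℝ, 3 / 2 < β ∧ β < 5 / 2 ∧ ∃ F : EuclideanSpace ℝ (Fin 3) → EuclideanSpace ℝ (Fin 3), ContDiffOn ℝ ((⊤ : ℕ∞) : WithTop ℕ∞) F {0}ᶜ ∧ (∀ c : ℝ, 0 < c → ∀ x, F (c • x) = (c ^ (-β)) • F x) ∧ (∀ x, x ≠ 0 → Literature.Analysis.FluidPDE.VectorCalculus.divergence F x = 0) ∧ (∃ x, x ≠ 0 ∧ Literature.Analysis.FluidPDE.curl F x ≠ 0) ∧ ∃ (u₀ : EuclideanSpace ℝ (Fin 3) → EuclideanSpace ℝ (Fin 3)) (U : ℝ → EuclideanSpace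 ℝ (Fin 3) → EuclideanSpace ℝ (Fin 3)) (P : ℝ → EuclideanSpace ℝ (Fin 3) → ℝ), Literature.Analysis.FluidPDE.IsGlobalLerayHopf 1 (fun _ => F) u₀ U ∧ Literature.Analysis.FluidPDE.IsSuitableWeakSolutionOn (Literature.Analysis.FluidPDE.slab (EuclideanSpace ℝ (Fin 3)) (Ioi 0) isOpen_Ioi) 1 (fun _ => F) U P ∧ (∃ C : ℝ, ∀ R : ℝ, 1 ≤ R → ∀ᶠ T in atTop, Literature.Analysis.FluidPDE.timeMean (fun t => ∫ x in {x : EuclideanSpace ℝ (Fin 3) | R < ‖x‖ ∧ ‖x‖ < 2 * R}, ‖U t x‖ ^ 2) T ≤ C * R ^ (4 - β)) ∧ ∃ c : ℝ, 0 < c ∧ ∃ R₀ : ℝ, ∃ G : ℝ → EuclideanSpace ℝ (Fin 3) → EuclideanSpace ℝ (Fin 3) →L[ℝ] EuclideanSpace ℝ (Fin 3), Literature.Analysis.FluidPDE.HasWeakSpatialGradientOn (Literature.Analysis.FluidPDE.slab (EuclideanSpace ℝ (Fin 3)) (Ioi 0) isOpen_Ioi) U G ∧ ∀ R : ℝ,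 R₀ ≤ R → ∃ᶠ T in atTop, c * R ^ ((7 - 3 * β) / 2) ≤ Literature.Analysis.FluidPDE.timeMean (fun t => ∫ x in {x : EuclideanSpace ℝ (Fin 3) | R < ‖x‖ ∧ ‖x‖ < 2 * R}, Literature.Analysis.FluidPDE.frobeniusNormSq (G t x)) T

/-- item stmt-AnomalousDissipation-2972 · support · rank 9 · closed · moot by None · by planner
sources: Frisch1995, CaffarelliKohnNirenberg1982, EscauriazaSereginSverak2003
[support, provable now] X ⟹ arena statement. Plan: given (β,F,u₀,U,P,C,c,R₀,G) from
KolmogorovExponents put R_j := 2^j·max(1,R₀) → ∞, ν_j := R_j^{(β−3)/2} → 0 (β < 3), u_j(s,y) :=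
R_j^{(β−1)/2} U(R_j^{(β+1)/2}s, R_j y), u₀ⱼ := R_j^{(β−1)/2}u₀(R_j·), G_j := R_j^{(β+1)/2}·(G∘Φ_j).
Covariance = the tree's PROVED lemmas IsDistributionalNSSolutionOn.stRescale /
IsSuitableWeakSolutionOn.stRescale / HasWeakSpatialGradientOn.stRescale with α = R^{(β−1)/2}, γ = R,
time factor αγ = R^{(β+1)/2}, viscosity α·1/γ = R^{(β−3)/2}, force α²γ·F(γ·) = R^{β}·R^{−β}F = F by
homogeneity; the Leray–Hopf fields transform as in the proved IsLerayHopfOn.nsRescale_holds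
(generalise LerayHopfNSRescale.lean from (c, c, c²) to (α, γ, αγ): energies scale by α²γ^{−3},
dissipation integrals consistently, forcing pairings likewise; weak continuity and strong attainment
are invariant). Bookkeeping: ∫_{A₁}|u_j(s)|² = R^{β−4}∫_{A_R}|U(t)|², ν_j∫_{A₁}|G_j(s)|² =
R^{(3β−7)/2}∫_{A_R}|G(t)|² at t = R^{(β+1)/2}s; timeMean (g∘(λ·)) T = timeMean g (λT); `∀ᶠ/∃ᶠ T in
atTop` are invariant under T ↦ λT, λ > 0. Hence E := C, ε := c. Sources: tree
SpaceTimeRescaling.lean, SuitableWeakRescaling.lean, LerayHopfNSRescale.lean; Frisch -/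
@[route_item "route-AnomalousDissipation-HomogeneousForceArena"]
def ScalingConjugacy : Prop :=
  KolmogorovExponents → ArenaZerothLaw

/-- item stmt-AnomalousDissipation-2973 · support · rank 9 · closed · moot by None · by planner
sources: DoeringFoias2002, Frisch1995
[support, provable now — the Doering–Foias LOWER bound transplanted to the arena; found while
planning] ∀ β ∈ (3/2,5/2), ∀ stirrer F (homogeneous −β, C^∞ and div-free off 0, curl F ≢ 0) ∃ ε =
ε(β,F) > 0 such that EVERY global Leray–Hopf solution U of NS₁(F) (any L² datum) has, on EVERY shell
R ≥ 1, shell-energy Cesàro means ≥ ε R^{4−β} frequently in T. So all solutions sit at or above the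
inertial energy level; KolmogorovExponents asks for one that saturates this floor, laminar states
exceed it by R^{3−β}: the alternative is sharp on the energy side. Proof plan: suppose the Cesàro
means of ∫_{A_R}|U|² are eventually ≤ εR^{4−β}. Test the weak formulation (IsWeakNSSolutionOn on
[0,T′), T′ > T) with ψ_R(x)θ(t/T): ψ ∈ C_c^∞(A₁; ℝ³) divergence-free with ∫_{A₁}F·ψ = 1 (exists
because F|_{A₁} is not a gradient: a div-free gradient is ∇h with h harmonic, and curl F ≢ 0
somewhere ⇒ by homogeneity curl F ≢ 0 on A₁), θ ∈ C_c^∞([0,1)) with θ = 1 near 0. Homogeneity: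
∫F·ψ_R = R^{3−β}. Nonlinear term ≤ ‖∇ψ‖_∞R^{−1}∫_{A_R}|U|² ⇒ Cesàro-mean ≤ CεR^{3−β}; viscous term ≤
R^{−2}(∫_{A_R}|U|²)^{1/2}R^{3/2}‖Δψ‖₂ ⇒ mean ≤ Cε^{1/2}R^{(3−β)/2} ≤ Cε^{1/2}R^{3−β} for R ≥ 1; the
θ′-term is ≤ (C/T)·(mean of |∫ -/
@[route_item "route-AnomalousDissipation-HomogeneousForceArena"]
def InertialEnergyFloor : Prop :=
  ∀ β : ℝ, 3 / 2 < β → β < 5 / 2 → ∀ F : EuclideanSpace ℝ (Fin 3) → EuclideanSpace ℝ (Fin 3), ContDiffOn ℝ ((⊤ : ℕ∞) : WithTop ℕ∞) F {0}ᶜ → (∀ c : ℝ, 0 < c → ∀ x, F (c • x) = (c ^ (-β)) • F x) → (∀ x, x ≠ 0 → Literature.Analysis.FluidPDE.VectorCalculus.divergence F x = 0) → (∃ x, x ≠ 0 ∧ Literature.Analysis.FluidPDE.curl F x ≠ 0) → ∃ ε : ℝ, 0 < ε ∧ ∀ (u₀ : EuclideanSpace ℝ (Fin 3) → EuclideanSpace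 ℝ (Fin 3)) (U : ℝ → EuclideanSpace ℝ (Fin 3) → EuclideanSpace ℝ (Fin 3)), Literature.Analysis.FluidPDE.IsGlobalLerayHopf 1 (fun _ => F) u₀ U → ∀ R : ℝ, 1 ≤ R → ∃ᶠ T in atTop, ε * R ^ (4 - β) ≤ Literature.Analysis.FluidPDE.timeMean (fun t => ∫ x in {x : EuclideanSpace ℝ (Fin 3) | R < ‖x‖ ∧ ‖x‖ < 2 * R}, ‖U t x‖ ^ 2) T

/-- item stmt-AnomalousDissipation-2974 · support · rank 9 · closed · moot by None · by planner
sources: Leray1934, CaffarelliKohnNirenberg1982, LemarieRieusset2016, RobinsonRodrigoSadowski2016, OzanskiPooley2018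
[support, known-type result feeding KolmogorovSaturation / NoConicalDodger provers] ∀ β ∈ (3/2,5/2),
∀ F homogeneous of degree −β, C^∞ and div-free off 0 (hence F = F·1_{B₁} + F·1_{B₁ᶜ} ∈ L^{6/5+δ}(ℝ³)
+ L²(ℝ³) ⊂ Ḣ⁻¹ + L², steady), ∀ ν > 0, ∀ u₀ ∈ L²(ℝ³) weakly divergence-free: there is a GLOBAL
Leray–Hopf solution U of NS_ν forced by (t ↦ F) with datum u₀ (tree E-side IsGlobalLerayHopf: energy
inequalities with the work term ∫∫⟨F,U⟩, weak L²-continuity, strong attainment of the datum) which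
is moreover CKN-suitable with a pressure P on the open slab (0,∞)×ℝ³ (IsSuitableWeakSolutionOn:
distributional equations, local energy classes, P ∈ L^{3/2}_loc, local energy inequality). Proof
plan: Leray's regularised scheme or Galerkin WITH FORCE (adapt the tree's NSLerayRegularised* files,
which prove leray_existence_R3 unforced, and the torus-side hopf_existence_torus_holds): a priori
bound d/dt‖u‖² + ν‖∇u‖² ≤ (ν/2)‖∇u‖² + Cν⁻¹‖F₁‖²_{L^{6/5}} + 2‖F₂‖_{L²}‖u‖_{L²} (Sobolev Ḣ¹ ⊂ L⁶),
Grönwall on [0,T] for every T; local energy inequality by CKN's argument (retarded mollification or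
limit of the scheme), where the linear term ∫∫F·u_nφ → ∫∫F·uφ because Fφ ∈ L^∞_tL^{6/5+δ}_x pairs
with the stron -/
@[route_item "route-AnomalousDissipation-HomogeneousForceArena"]
def ForcedLerayExistence : Prop :=
  ∀ β : ℝ, 3 / 2 < β → β < 5 / 2 → ∀ F : EuclideanSpace ℝ (Fin 3) → EuclideanSpace ℝ (Fin 3), ContDiffOn ℝ ((⊤ : ℕ∞) : WithTop ℕ∞) F {0}ᶜ → (∀ c : ℝ, 0 < c → ∀ x, F (c • x) = (c ^ (-β)) • F x) → (∀ x, x ≠ 0 → Literature.Analysis.FluidPDE.VectorCalculus.divergence F x = 0) → ∀ ν : ℝ, 0 < ν → ∀ u₀ : EuclideanSpace ℝ (Fin 3) → EuclideanSpace ℝ (Fin 3), MemLp u₀ 2 volume → Literature.Analysis.FluidPDE.IsWeaklyDivFree u₀ → ∃ (U : ℝ → EuclideanSpace ℝ (Fin 3) → EuclideanSpace ℝ (Fin 3)) (P : ℝ → EuclideanSpace ℝ (Fin 3) → ℝ), Literature.Analysis.FluidPDE.IsGlobalLerayHopf ν (fun _ => F) u₀ U ∧ Literature.Analysis.FluidPDE.IsSuitableWeakSolutionOn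 (Literature.Analysis.FluidPDE.slab (EuclideanSpace ℝ (Fin 3)) (Ioi 0) isOpen_Ioi) ν (fun _ => F) U P

/-- item stmt-AnomalousDissipation-2975 · assembly · rank 1 · closed · moot by None · by planner
[assembly] NoConicalDodger → KolmogorovSaturation → ScalingConjugacy → ArenaZerothLaw: unpack
KolmogorovSaturation (β, F, u₀, U, P, energy bound), feed NoConicalDodger to get (c, R₀, G,
dissipation floor), repack as KolmogorovExponents, apply ScalingConjugacy. Pure ∃-bookkeeping — the
term-mode proof `assembly_glue : Assembly` elaborates in the planner's Sketch.lean (rc 0). The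
endpoint is the ARENA statement ArenaZerothLaw, not AnomalousDissipation: no transfer to T³ is
claimed (card §Assembly sketch; precedent route Parity/CubicRoots ending in CubicBH). -/
@[route_item "route-AnomalousDissipation-HomogeneousForceArena"]
def Assembly : Prop :=
  NoConicalDodger → KolmogorovSaturation → ScalingConjugacy → ArenaZerothLaw

end Summit.AnomalousDissipation.AnomalousDissipation.Theses.HomogeneousForceArena
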